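import Mathlib

/-!
# Counting by a certificate of inclusion–exclusion coefficients (generic)

A weight `W` that depends on a configuration `ω` only through the Boolean vector of `k` **facts**
`t ω = fun i => decide (fact i ω)` is summed over the configurations satisfying `P` by a signed
combination of the counts `N U = #{ω | P ω ∧ ∀ i ∈ U, ¬ fact i ω}`:

`∑ ω ∈ univ.filter P, W (t ω) = ∑ (m, U) ∈ L, m · N U`

as soon as the list `L` of coefficients satisfies the **certificate** `∀ t, ∑ (m, U) ∈ L, U ⊆ zeros t → m = W t`
(`sum_weight_eq_of_cert`).  The certificate is a finite statement about `L` and `W` alone (checked by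
`decide` when `k` is small); the counts `N U` are the «product» counts when the facts are existential
over independent parts (`FibreProductCount`).  This is the inclusion–exclusion step of the graph half
of the star-gadget theorem with the Möbius coefficients supplied rather than derived.
-/

namespace PercRepro

open Finset

/-- The zero set of a Boolean vector. -/
def zeros {k : ℕ} (t : Fin k → Bool) : Finset (Fin k) := univ.filter fun i => t i = false

/-- `U ⊆ zeros t` iff `t` vanishes on `U`. -/
theorem subset_zeros_iff {k : ℕ} (t : Fin k → Bool) (U : Finset (Fin k)) :
    U ⊆ zeros t ↔ ∀ i ∈ U, t i = false := by
  simp [zeros, Finset.subset_iff]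

/-- A finite sum of list sums is the list sum of the finite sums. -/
theorem sum_list_map_sum_comm {Ω α M : Type*} [AddCommMonoid M] (s : Finset Ω) (L : List α)
    (f : Ω → α → M) :
    ∑ ω ∈ s, (L.map (f ω)).sum = (L.map fun l => ∑ ω ∈ s, f ω l).sum := by
  induction L with
  | nil => simp
  | cons a L ih => simp [List.map_cons, List.sum_cons, Finset.sum_add_distrib, ih]

/-- **Counting by a certificate.**  If the coefficient list `L` reproduces the weight `W` on every
Boolean vector (`hcert`), the sum of `W` over the fact vectors of the configurations satisfying `P`
is the signed combination of the counts `#{ω | P ω ∧ ∀ i ∈ U, ¬ fact i ω}`. -/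
theorem sum_weight_eq_of_cert {Ω : Type*} [Fintype Ω] {k : ℕ}
    (P : Ω → Prop) [DecidablePred P] (fact : Fin k → Ω → Prop) [∀ i, DecidablePred (fact i)]
    (W : (Fin k → Bool) → ℤ) (L : List (ℤ × Finset (Fin k)))
    (hcert : ∀ t : Fin k → Bool,
      (L.map fun mU => if mU.2 ⊆ zeros t then mU.1 else 0).sum = W t) :
    ∑ ω ∈ univ.filter P, W (fun i => decide (fact i ω)) =
      (L.map fun mU =>
        mU.1 * ((univ.filter fun ω => P ω ∧ ∀ i ∈ mU.2, ¬ fact i ω).card : ℤ)).sum := by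
  have hcard : ∀ U : Finset (Fin k),
      ((univ.filter fun ω => P ω ∧ ∀ i ∈ U, ¬ fact i ω).card : ℤ) =
        ∑ ω ∈ univ.filter P, if U ⊆ zeros (fun i => decide (fact i ω)) then 1 else 0 := by
    intro U
    rw [← Finset.filter_filter, Finset.card_filter, Nat.cast_sum]
    refine Finset.sum_congr rfl fun ω _ => ?_
    simp only [subset_zeros_iff, decide_eq_false_iff_not, Nat.cast_ite, Nat.cast_one,
      Nat.cast_zero]
  simp_rw [hcard, Finset.mul_sum]
  rw [← sum_list_map_sum_comm]
  refine Finset.sum_congr rfl fun ω _ => ?_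
  rw [← hcert]
  congr 1
  refine List.map_congr_left fun mU _ => ?_
  split_ifs <;> simp

end PercRepro
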